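import Literature.AlgebraicGeometry.ComplexMultiplication.CMTypeEtaleEigenlines
import Literature.AlgebraicGeometry.Motives.HodgeStructure
import Mathlib.FieldTheory.IntermediateField.Adjoin.Algebra
import Mathlib.LinearAlgebra.DirectSum.Finsupp
import Mathlib.RingTheory.Flat.Basic
import HarnessLib

/-!
# The eigenblock and the eigenvalue field of an eigensystem of commuting endomorphisms (Deligne, LNM 900, §4: `H¹_B ⊗ ℂ = ⊕_σ H¹_{B,σ}`, read for one eigensystem)

Family `hodge`, layer `Literature/AlgebraicGeometry/ComplexMultiplication`; THEOREMS and four auxiliary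
DEFINITIONS of data (no named fact, nothing conditional — D-0026).  Written for the cell `pub-hodgecm2` (COR-CM),
junction B01, leaf B01-S, discharge architecture `HOME/b01/IDEA-2f` route L2-T («HeckeCMBlock», steps T1–T3) /
`HOME/b01/IDEA-1d` S4: the Hecke eigenblock of `H¹` of a Picard modular surface.  This file is the ALGEBRA half
(any `ℚ`-vector space `V`); the Hodge-theoretic half (`V = H¹(X(ℂ); ℚ)`: the sign pattern is a CM type, the
eigenblock is pure, reach) is `PureEigenblockOfCommutingEndomorphisms`, which feeds
`PureSubHodgeStructureReach.exists_hom_ne_zero_range_le_of_pure_submodule`.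

## Source, verbatim

* P. Deligne, *Hodge cycles on abelian varieties*, LNM 900 (1982), §4 (p. 30 of Milne's re-typeset edition, the
  display preceding Prop. 4.4): for a field `E` acting on `H¹_B(A)`, «`H¹_B(A) ⊗ ℂ = ⊕_{σ ∈ Hom(E,ℂ)} H¹_{B,σ}`»
  with `e ∈ E` acting on `H¹_{B,σ}` as `σ(e)`; Example 3.7 (pp. 25–26): `E ⊗_ℚ ℂ ≃ ℂ^S`, `S = Hom(E, ℂ)`.
  Here the field is not given in advance: it is PRODUCED from one eigensystem of a commutative algebra.

## Setting and what is proved (unconditional, sorry-free)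

DATA: a commutative `ℚ`-algebra `R` acting on a `ℚ`-vector space `V` (`act : R →ₐ[ℚ] End_ℚ V`; e.g. an algebra of
Hecke correspondences acting on `H¹`), and an EIGENSYSTEM `t : R →ₐ[ℚ] ℂ`.  It OCCURS if some `x ≠ 0` in
`ℂ ⊗_ℚ V` satisfies `(act a)_ℂ x = t(a) x` for all `a` (hypothesis `hocc`, spelled out).

* §0 `eigenblock act t = W(t) := ⋂_{t a = 0} ker (act a)` (the EIGENBLOCK), `eigenfield t = E(t) := ℚ(t(R)) ⊆ ℂ`
  (the EIGENVALUE FIELD, an `IntermediateField ℚ ℂ`), `eigenblockAction` (`a ↦ act a|_{W(t)}`, well defined as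
  `R` is commutative), `eigenblockAction_eq_zero` (`ker t` kills `W(t)`).
* §1 `mem_baseChange_of_forall_baseChange_eq_zero` (base change to `ℂ` commutes with joint kernels),
  `mem_baseChange_eigenblock_of_eigenvector` (every joint eigenvector of an eigensystem vanishing on `ker t` lies
  in `ℂ ⊗ W(t)`), **`ker_eigenblockAction_eq`** (`ker (act|_{W(t)}) = ker t` if `t` occurs),
  **`eigenblock_ne_bot`** (`W(t) ≠ 0` if `t` occurs).
* §2 (for `V` finite-dimensional and `t` occurring) `finiteDimensional_range`, `isField_range`,
  **`eigenfield_toSubalgebra`** (`ℚ(t(R)) = t(R) ≅ R / ker t`), `exists_apply_eq_of_mem_eigenfield`,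
  **`finiteDimensional_eigenfield`**, **`numberField_eigenfield`** (`E(t)` is a number field).
* §3 **`eigenfieldAction`** `ρ : E(t) →ₐ[ℚ] End_ℚ W(t)` with `ρ(t a) = act a|_{W(t)}` (`eigenfieldAction_apply`,
  `coe_eigenfieldAction_apply`).
* §4 `eigenvector_subtype_of_eigenfieldAction` (a joint `τ`-eigenvector of `ρ` in `ℂ ⊗ W(t)` is a joint
  eigenvector of the CONJUGATE EIGENSYSTEM `τ ∘ t` in `ℂ ⊗ V`), **`exists_eigenvector_ne_zero`** (every conjugate
  eigensystem `τ ∘ t`, `τ : E(t) → ℂ`, occurs — through the tree's `finrank_iInf_eigenspace_baseChange_mulLeft_eq_one`,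
  `E ⊗_ℚ ℂ ≅ ℂ^{Hom(E,ℂ)}`), `conj_eigenvector` (`conj ⊗ id` carries eigenvectors of `χ` to eigenvectors of `χ̄`).

Only `ℚ`- and `ℂ`-coefficients occur.  No semisimplicity of the action and no involution is needed.

## References

* [Deligne1982HodgeCycles] P. Deligne, *Hodge cycles on abelian varieties*, LNM 900 (1982), Example 3.7, §4.
* [Shimura1998] G. Shimura, *Abelian Varieties with Complex Multiplication and Modular Functions* (1998), §24.1.
-/
noncomputable section

open scoped TensorProduct
open Module

namespace Literature.AlgebraicGeometry.ComplexMultiplication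

/-! ## §0 The eigenblock, the eigenvalue field, the restricted action -/

section Algebra

variable {R : Type*} [CommRing R] [Algebra ℚ R] {V : Type*} [AddCommGroup V] [Module ℚ V]

/-- The **eigenblock** of the eigensystem `t : R → ℂ` of a commutative `ℚ`-algebra `R` acting on `V`: the joint
kernel `W(t) = ⋂_{a ∈ ker t} ker (act a)` of the ideal `ker t`. [cite: Deligne1982HodgeCycles, §4] -/
def eigenblock (act : R →ₐ[ℚ] Module.End ℚ V) (t : R →ₐ[ℚ] ℂ) : Submodule ℚ V :=
  ⨅ a : R, ⨅ (_ : t a = 0), LinearMap.ker (act a)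

/-- The **eigenvalue field** `E(t) = ℚ(t(R)) ⊆ ℂ` of the eigensystem `t` (the «Hecke field»).
[cite: Deligne1982HodgeCycles, §4] -/
def eigenfield (t : R →ₐ[ℚ] ℂ) : IntermediateField ℚ ℂ :=
  IntermediateField.adjoin ℚ (Set.range t)

variable (act : R →ₐ[ℚ] Module.End ℚ V) (t : R →ₐ[ℚ] ℂ)

/-- Membership in the eigenblock. [cite: Deligne1982HodgeCycles, §4 (p. 30, `H¹_B ⊗ ℂ = ⊕_σ H¹_{B,σ}`, `e ∈ E` acting on `H¹_{B,σ}` as `σ(e)`)] -/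
theorem mem_eigenblock_iff {v : V} : v ∈ eigenblock act t ↔ ∀ a : R, t a = 0 → act a v = 0 := by
  simp [eigenblock, Submodule.mem_iInf]

/-- The eigenvalues lie in the eigenvalue field. [cite: Deligne1982HodgeCycles, §4 (p. 30, `H¹_B ⊗ ℂ = ⊕_σ H¹_{B,σ}`, `e ∈ E` acting on `H¹_{B,σ}` as `σ(e)`)] -/
theorem apply_mem_eigenfield (a : R) : t a ∈ eigenfield t :=
  IntermediateField.subset_adjoin ℚ _ ⟨a, rfl⟩

/-- The eigenblock is stable under the (commutative) algebra. [cite: Deligne1982HodgeCycles, §4 (p. 30, `H¹_B ⊗ ℂ = ⊕_σ H¹_{B,σ}`, `e ∈ E` acting on `H¹_{B,σ}` as `σ(e)`)] -/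
theorem apply_mem_eigenblock (a : R) {v : V} (hv : v ∈ eigenblock act t) : act a v ∈ eigenblock act t := by
  rw [mem_eigenblock_iff] at hv ⊢
  intro b hb
  rw [← Module.End.mul_apply, ← map_mul, mul_comm, map_mul, Module.End.mul_apply, hv b hb, map_zero]

/-- The action restricted to the eigenblock, `a ↦ act a |_{W(t)}`. [cite: Deligne1982HodgeCycles, §4 (p. 30, `H¹_B ⊗ ℂ = ⊕_σ H¹_{B,σ}`, `e ∈ E` acting on `H¹_{B,σ}` as `σ(e)`)] -/
def eigenblockAction : R →ₐ[ℚ] Module.End ℚ (eigenblock act t) where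
  toFun a := (act a).restrict (fun _ hv ↦ apply_mem_eigenblock act t a hv)
  map_one' := by ext v; simp
  map_mul' a b := by ext v; simp
  map_zero' := by ext v; simp
  map_add' a b := by ext v; simp
  commutes' c := by ext v; simp [Algebra.algebraMap_eq_smul_one]

/-- The restricted action is `act a` on elements. [cite: Deligne1982HodgeCycles, §4 (p. 30, `H¹_B ⊗ ℂ = ⊕_σ H¹_{B,σ}`, `e ∈ E` acting on `H¹_{B,σ}` as `σ(e)`)] -/
@[simp]
theorem coe_eigenblockAction_apply (a : R) (w : eigenblock act t) :
    (eigenblockAction act t a w : V) = act a w := rfl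

/-- `ker t` acts by zero on the eigenblock. [cite: Deligne1982HodgeCycles, §4 (p. 30, `H¹_B ⊗ ℂ = ⊕_σ H¹_{B,σ}`, `e ∈ E` acting on `H¹_{B,σ}` as `σ(e)`)] -/
theorem eigenblockAction_eq_zero {a : R} (ha : t a = 0) : eigenblockAction act t a = 0 := by
  ext w
  simp only [coe_eigenblockAction_apply, LinearMap.zero_apply, ZeroMemClass.coe_zero]
  exact (mem_eigenblock_iff act t).1 w.2 a ha

/-! ## §1 Joint eigenvectors of the conjugate eigensystems live in the complexified eigenblock -/

/-- **Base change commutes with joint kernels** (over the field `ℚ`, `ℂ = ⊕ ℚ` is free): if `x ∈ ℂ ⊗_ℚ V` is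
killed by the complexifications of a family of `ℚ`-linear maps `f i`, then `x` lies in the complexification
`N_ℂ = range (N ↪ V)_ℂ` of any subspace `N` containing the joint kernel of the `f i` (read `x` in a `ℚ`-basis of
`ℂ`: its `V`-valued coordinates are killed by every `f i`). [cite: Deligne1982HodgeCycles, §4 (p. 30, `H¹_B ⊗ ℂ = ⊕_σ H¹_{B,σ}`, `e ∈ E` acting on `H¹_{B,σ}` as `σ(e)`)] -/
theorem mem_baseChange_of_forall_baseChange_eq_zero {ι : Type*} (f : ι → V →ₗ[ℚ] V) (N : Submodule ℚ V)
    (hN : ∀ v : V, (∀ i, f i v = 0) → v ∈ N) {x : ℂ ⊗[ℚ] V} (hx : ∀ i, (f i).baseChange ℂ x = 0) :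
    x ∈ N.baseChange ℂ := by
  classical
  let bC := Basis.ofVectorSpace ℚ ℂ
  let Θ : ℂ ⊗[ℚ] V ≃ₗ[ℚ] (Basis.ofVectorSpaceIndex ℚ ℂ →₀ V) :=
    (TensorProduct.congr bC.repr (LinearEquiv.refl ℚ V)).trans
      (TensorProduct.finsuppScalarLeft ℚ V (Basis.ofVectorSpaceIndex ℚ ℂ))
  -- the coordinates of `g_ℂ y` are `g` of the coordinates of `y`
  have hΘ : ∀ (g : V →ₗ[ℚ] V) (y : ℂ ⊗[ℚ] V) (i), Θ ((g.restrictScalars ℚ).baseChange ℂ y) i = g (Θ y i) := by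
    intro g y i
    induction y using TensorProduct.induction_on with
    | zero => simp
    | tmul c v => simp [Θ, LinearMap.baseChange_tmul, TensorProduct.finsuppScalarLeft_apply_tmul_apply]
    | add y z hy hz => simp only [map_add, Finsupp.add_apply, hy, hz]
  -- every coordinate of `x` lies in `N`
  have hcoord : ∀ i, Θ x i ∈ N := fun i ↦ hN _ fun j ↦ by
    have h := hΘ (f j) x i
    rw [show ((f j).restrictScalars ℚ) = f j from rfl, hx j, map_zero, Finsupp.zero_apply] at h
    exact h.symm
  -- `x = Σ_i bC i ⊗ (Θ x i)`
  have hsymm : ∀ (i) (v : V), Θ.symm (Finsupp.single i v) = bC i ⊗ₜ[ℚ] v := by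
    intro i v
    simp [Θ, LinearEquiv.trans_symm, TensorProduct.finsuppScalarLeft_symm_apply_single]
  have hx' : x = (Θ x).sum fun i v ↦ bC i ⊗ₜ[ℚ] v := by
    conv_lhs => rw [← Θ.symm_apply_apply x, ← Finsupp.sum_single (Θ x)]
    rw [map_finsuppSum]
    exact Finsupp.sum_congr fun i _ ↦ hsymm i _
  rw [hx']
  exact Submodule.sum_mem _ fun i _ ↦ Submodule.tmul_mem_baseChange_of_mem _ (hcoord i)

/-- **A joint eigenvector of any eigensystem vanishing on `ker t` lies in the complexified eigenblock**
`W(t)_ℂ ⊆ ℂ ⊗_ℚ V`. [cite: Deligne1982HodgeCycles, §4] -/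
theorem mem_baseChange_eigenblock_of_eigenvector {χ : R → ℂ} (hχ : ∀ a, t a = 0 → χ a = 0)
    {x : ℂ ⊗[ℚ] V} (hx : ∀ a, (act a).baseChange ℂ x = χ a • x) :
    x ∈ (eigenblock act t).baseChange ℂ := by
  refine mem_baseChange_of_forall_baseChange_eq_zero (fun a : {a : R // t a = 0} ↦ (act a.1 : V →ₗ[ℚ] V))
    (eigenblock act t) (fun v hv ↦ (mem_eigenblock_iff act t).2 fun a ha ↦ hv ⟨a, ha⟩) fun a ↦ ?_
  rw [hx a.1, hχ a.1 a.2, zero_smul]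

/-- The complexified restricted action is the action on the complexified eigenblock:
`(W ↪ V)_ℂ ∘ (act a|_W)_ℂ = (act a)_ℂ ∘ (W ↪ V)_ℂ`. [cite: Deligne1982HodgeCycles, §4 (p. 30, `H¹_B ⊗ ℂ = ⊕_σ H¹_{B,σ}`, `e ∈ E` acting on `H¹_{B,σ}` as `σ(e)`)] -/
theorem baseChange_subtype_eigenblockAction (a : R) (y : ℂ ⊗[ℚ] eigenblock act t) :
    (eigenblock act t).subtype.baseChange ℂ ((eigenblockAction act t a).baseChange ℂ y) =
      (act a).baseChange ℂ ((eigenblock act t).subtype.baseChange ℂ y) := by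
  rw [← LinearMap.comp_apply, ← LinearMap.baseChange_comp, ← LinearMap.comp_apply,
    ← LinearMap.baseChange_comp]
  rfl

/-- **The eigensystem is determined by the action on the eigenblock**: if `t` occurs (has a non-zero joint
eigenvector in `ℂ ⊗_ℚ V`), then `act a` kills the eigenblock only if `t a = 0`.  With `eigenblockAction_eq_zero`:
`ker (act|_{W(t)}) = ker t`. [cite: Deligne1982HodgeCycles, §4] -/
theorem ker_eigenblockAction_eq (hocc : ∃ x : ℂ ⊗[ℚ] V, x ≠ 0 ∧ ∀ a, (act a).baseChange ℂ x = t a • x) :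
    RingHom.ker (eigenblockAction act t) = RingHom.ker t := by
  ext a
  simp only [RingHom.mem_ker]
  refine ⟨fun ha ↦ ?_, eigenblockAction_eq_zero act t⟩
  obtain ⟨x, hx0, hx⟩ := hocc
  obtain ⟨y, rfl⟩ : x ∈ (eigenblock act t).baseChange ℂ :=
    mem_baseChange_eigenblock_of_eigenvector act t (χ := t) (fun _ h ↦ h) hx
  have h := hx a
  rw [← baseChange_subtype_eigenblockAction, ha, LinearMap.baseChange_zero, LinearMap.zero_apply,
    map_zero] at h
  exact (smul_eq_zero.1 h.symm).resolve_right hx0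

/-- **An occurring eigensystem has a non-zero eigenblock.** [cite: Deligne1982HodgeCycles, §4] -/
theorem eigenblock_ne_bot (hocc : ∃ x : ℂ ⊗[ℚ] V, x ≠ 0 ∧ ∀ a, (act a).baseChange ℂ x = t a • x) :
    eigenblock act t ≠ ⊥ := by
  intro hbot
  obtain ⟨x, hx0, hx⟩ := hocc
  have hmem := mem_baseChange_eigenblock_of_eigenvector act t (χ := t) (fun _ h ↦ h) hx
  rw [hbot, Submodule.baseChange_bot] at hmem
  exact hx0 ((Submodule.mem_bot ℂ).1 hmem)

end Algebra

/-! ## §2 The eigenvalue field is a number field acting on the eigenblock -/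

section Field

variable {R : Type*} [CommRing R] [Algebra ℚ R] {V : Type*} [AddCommGroup V] [Module ℚ V]
  (act : R →ₐ[ℚ] Module.End ℚ V) (t : R →ₐ[ℚ] ℂ)

/-- `ℚ[t(R)] = t(R)`: the subalgebra generated by the eigenvalues is the range of `t`. [cite: Deligne1982HodgeCycles, §4 (p. 30, `H¹_B ⊗ ℂ = ⊕_σ H¹_{B,σ}`, `e ∈ E` acting on `H¹_{B,σ}` as `σ(e)`)] -/
theorem adjoin_range_eq_range : Algebra.adjoin ℚ (Set.range t) = t.range :=
  le_antisymm (Algebra.adjoin_le (by rintro _ ⟨a, rfl⟩; exact ⟨a, rfl⟩))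
    (by rintro _ ⟨a, rfl⟩; exact Algebra.subset_adjoin ⟨a, rfl⟩)

variable [FiniteDimensional ℚ V]

/-- **The range of an occurring eigensystem is finite over `ℚ`**: `t(R) ≅ R / ker t = R / ker (act|_W) ↪ End_ℚ W(t)`.
[cite: Deligne1982HodgeCycles, §4] -/
theorem finiteDimensional_range (hocc : ∃ x : ℂ ⊗[ℚ] V, x ≠ 0 ∧ ∀ a, (act a).baseChange ℂ x = t a • x) :
    FiniteDimensional ℚ t.range := by
  have hker := ker_eigenblockAction_eq act t hocc
  -- `R / ker t ≃ R / ker act|_W ≃ range (act|_W) ⊆ End_ℚ W`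
  let e : t.range ≃ₐ[ℚ] (eigenblockAction act t).range :=
    ((Ideal.quotientKerEquivRange t).symm.trans (Ideal.quotientEquivAlgOfEq ℚ hker.symm)).trans
      (Ideal.quotientKerEquivRange (eigenblockAction act t))
  haveI : FiniteDimensional ℚ (eigenblockAction act t).range :=
    FiniteDimensional.of_injective (eigenblockAction act t).range.val.toLinearMap Subtype.val_injective
  exact Module.Finite.equiv e.symm.toLinearEquiv

/-- **The range of an occurring eigensystem is a field** (a domain finite over `ℚ`). [cite: Deligne1982HodgeCycles, §4 (p. 30, `H¹_B ⊗ ℂ = ⊕_σ H¹_{B,σ}`, `e ∈ E` acting on `H¹_{B,σ}` as `σ(e)`)] -/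
theorem isField_range (hocc : ∃ x : ℂ ⊗[ℚ] V, x ≠ 0 ∧ ∀ a, (act a).baseChange ℂ x = t a • x) :
    IsField t.range := by
  haveI := finiteDimensional_range act t hocc
  haveI : Algebra.IsIntegral ℚ t.range := Algebra.IsIntegral.of_finite ℚ _
  exact isField_of_isIntegral_of_isField' (Field.toIsField ℚ)

/-- **The eigenvalue field is the range**: `ℚ(t(R)) = t(R)` as subalgebras of `ℂ`, for an occurring eigensystem.
[cite: Deligne1982HodgeCycles, §4 (p. 30, `H¹_B ⊗ ℂ = ⊕_σ H¹_{B,σ}`, `e ∈ E` acting on `H¹_{B,σ}` as `σ(e)`)] -/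
theorem eigenfield_toSubalgebra (hocc : ∃ x : ℂ ⊗[ℚ] V, x ≠ 0 ∧ ∀ a, (act a).baseChange ℂ x = t a • x) :
    (eigenfield t).toSubalgebra = t.range := by
  rw [eigenfield, IntermediateField.adjoin_eq_algebra_adjoin, adjoin_range_eq_range]
  intro x hx
  rw [adjoin_range_eq_range] at hx ⊢
  by_cases hx0 : x = 0
  · rw [hx0, inv_zero]; exact zero_mem _
  obtain ⟨y, hy⟩ := (isField_range act t hocc).mul_inv_cancel (a := ⟨x, hx⟩)
    (fun h ↦ hx0 (congrArg Subtype.val h))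
  have hxy : x * (y : ℂ) = 1 := congrArg Subtype.val hy
  rw [inv_eq_of_mul_eq_one_right hxy]
  exact y.2

/-- Elements of the eigenvalue field are values of `t`, for an occurring eigensystem. [cite: Deligne1982HodgeCycles, §4 (p. 30, `H¹_B ⊗ ℂ = ⊕_σ H¹_{B,σ}`, `e ∈ E` acting on `H¹_{B,σ}` as `σ(e)`)] -/
theorem exists_apply_eq_of_mem_eigenfield (hocc : ∃ x : ℂ ⊗[ℚ] V, x ≠ 0 ∧ ∀ a, (act a).baseChange ℂ x = t a • x)
    (e : eigenfield t) : ∃ a : R, t a = e := by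
  have h : (e : ℂ) ∈ (eigenfield t).toSubalgebra := e.2
  rw [eigenfield_toSubalgebra act t hocc] at h
  exact h

/-- **The eigenvalue field of an occurring eigensystem is a number field.** [cite: Deligne1982HodgeCycles, §4] -/
theorem finiteDimensional_eigenfield
    (hocc : ∃ x : ℂ ⊗[ℚ] V, x ≠ 0 ∧ ∀ a, (act a).baseChange ℂ x = t a • x) :
    FiniteDimensional ℚ (eigenfield t) := by
  haveI := finiteDimensional_range act t hocc
  have h := eigenfield_toSubalgebra act t hocc
  change FiniteDimensional ℚ (eigenfield t).toSubalgebra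
  exact Module.Finite.equiv (Subalgebra.equivOfEq _ _ h).symm.toLinearEquiv

/-- **The eigenvalue field of an occurring eigensystem is a number field.** [cite: Deligne1982HodgeCycles, §4] -/
theorem numberField_eigenfield (hocc : ∃ x : ℂ ⊗[ℚ] V, x ≠ 0 ∧ ∀ a, (act a).baseChange ℂ x = t a • x) :
    NumberField (eigenfield t) :=
  haveI := finiteDimensional_eigenfield act t hocc
  ⟨⟩

end Field

/-! ## §3 The action of the eigenvalue field on the eigenblock -/

section Action

variable {R : Type*} [CommRing R] [Algebra ℚ R] {V : Type*} [AddCommGroup V] [Module ℚ V] [FiniteDimensional ℚ V]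
  (act : R →ₐ[ℚ] Module.End ℚ V) (t : R →ₐ[ℚ] ℂ)

/-- **The eigenvalue field acts on the eigenblock**: `ρ : E(t) = ℚ(t(R)) → End_ℚ W(t)`, `ρ(t a) = act a|_{W(t)}` — the
action `act|_{W(t)} : R → End_ℚ W(t)` kills `ker t` (`eigenblockAction_eq_zero`), so factors through
`R / ker t ≅ t(R) = E(t)` (`eigenfield_toSubalgebra`, for an occurring eigensystem on a finite-dimensional `V`).
[cite: Deligne1982HodgeCycles, §4 («`e ∈ E` acts on `H_σ` as `σ(e)`»)] -/
def eigenfieldAction (hocc : ∃ x : ℂ ⊗[ℚ] V, x ≠ 0 ∧ ∀ a, (act a).baseChange ℂ x = t a • x) :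
    eigenfield t →ₐ[ℚ] Module.End ℚ (eigenblock act t) :=
  (Ideal.Quotient.liftₐ (RingHom.ker t) (eigenblockAction act t)
      (fun _ ha ↦ eigenblockAction_eq_zero act t ha)).comp
    ((Ideal.quotientKerEquivRange t).symm.toAlgHom.comp
      ((IntermediateField.val (eigenfield t)).codRestrict t.range fun e ↦ by
        rw [← eigenfield_toSubalgebra act t hocc]
        exact e.2))

/-- `ρ(t a) = act a|_{W(t)}`. [cite: Deligne1982HodgeCycles, §4 (p. 30, `H¹_B ⊗ ℂ = ⊕_σ H¹_{B,σ}`, `e ∈ E` acting on `H¹_{B,σ}` as `σ(e)`)] -/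
theorem eigenfieldAction_apply (hocc : ∃ x : ℂ ⊗[ℚ] V, x ≠ 0 ∧ ∀ a, (act a).baseChange ℂ x = t a • x)
    {e : eigenfield t} {a : R} (ha : t a = e) :
    eigenfieldAction act t hocc e = eigenblockAction act t a := by
  have hcod : ((IntermediateField.val (eigenfield t)).codRestrict t.range fun e ↦ by
        rw [← eigenfield_toSubalgebra act t hocc]; exact e.2) e = t.rangeRestrict a :=
    Subtype.ext (by simp [ha])
  have hsymm : (Ideal.quotientKerEquivRange t).symm (t.rangeRestrict a) =
      Ideal.Quotient.mk (RingHom.ker t) a := by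
    rw [AlgEquiv.symm_apply_eq]
    simp [Ideal.quotientKerEquivRange]
  show (Ideal.Quotient.liftₐ (RingHom.ker t) (eigenblockAction act t)
      (fun _ ha ↦ eigenblockAction_eq_zero act t ha))
    ((Ideal.quotientKerEquivRange t).symm (((IntermediateField.val (eigenfield t)).codRestrict t.range fun e ↦ by
        rw [← eigenfield_toSubalgebra act t hocc]; exact e.2) e)) = _
  rw [hcod, hsymm]
  exact Ideal.Quotient.lift_mk _ _ _

/-- `ρ(e) w = act a w` whenever `t a = e`. [cite: Deligne1982HodgeCycles, §4 (p. 30, `H¹_B ⊗ ℂ = ⊕_σ H¹_{B,σ}`, `e ∈ E` acting on `H¹_{B,σ}` as `σ(e)`)] -/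
theorem coe_eigenfieldAction_apply (hocc : ∃ x : ℂ ⊗[ℚ] V, x ≠ 0 ∧ ∀ a, (act a).baseChange ℂ x = t a • x)
    {e : eigenfield t} {a : R} (ha : t a = e) (w : eigenblock act t) :
    (eigenfieldAction act t hocc e w : V) = act a w := by
  rw [eigenfieldAction_apply act t hocc ha, coe_eigenblockAction_apply]

/-! ## §4 Eigenvectors: transfer, non-vanishing, complex conjugation -/

/-- **A joint `τ`-eigenvector of `ρ` in `ℂ ⊗ W(t)` is, in `ℂ ⊗ V`, a joint eigenvector of the CONJUGATE
EIGENSYSTEM `τ ∘ t : R → E(t) → ℂ`.** [cite: Deligne1982HodgeCycles, §4] -/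
theorem eigenvector_subtype_of_eigenfieldAction
    (hocc : ∃ x : ℂ ⊗[ℚ] V, x ≠ 0 ∧ ∀ a, (act a).baseChange ℂ x = t a • x) (τ : eigenfield t →+* ℂ)
    {y : ℂ ⊗[ℚ] eigenblock act t} (hy : ∀ e, (eigenfieldAction act t hocc e).baseChange ℂ y = τ e • y) (a : R) :
    (act a).baseChange ℂ ((eigenblock act t).subtype.baseChange ℂ y) =
      τ ⟨t a, apply_mem_eigenfield t a⟩ • (eigenblock act t).subtype.baseChange ℂ y := by
  rw [← baseChange_subtype_eigenblockAction, ← eigenfieldAction_apply act t hocc (e := ⟨t a, _⟩) rfl, hy,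
    map_smul]

/-- **Every conjugate eigensystem `τ ∘ t` (`τ : E(t) → ℂ`) OCCURS**: it has a non-zero joint eigenvector in
`ℂ ⊗_ℚ V` — `W(t) ≠ 0` is an `E(t)`-vector space, `e ↦ ρ(e) w₀` embeds the regular representation `E(t) ↪ W(t)`
(base change is exact over `ℚ`), and `ℂ ⊗_ℚ E(t) ≅ ℂ^{Hom(E(t), ℂ)}` has a line on which `E(t)` acts through `τ`
(`finrank_iInf_eigenspace_baseChange_mulLeft_eq_one`). [cite: Deligne1982HodgeCycles, Example 3.7 and §4] -/
theorem exists_eigenvector_ne_zero (hocc : ∃ x : ℂ ⊗[ℚ] V, x ≠ 0 ∧ ∀ a, (act a).baseChange ℂ x = t a • x)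
    (τ : eigenfield t →+* ℂ) :
    ∃ x : ℂ ⊗[ℚ] V, x ≠ 0 ∧ ∀ a, (act a).baseChange ℂ x = τ ⟨t a, apply_mem_eigenfield t a⟩ • x := by
  classical
  haveI := finiteDimensional_eigenfield act t hocc
  obtain ⟨w₀, hw₀, hw₀0⟩ := Submodule.exists_mem_ne_zero_of_ne_bot (eigenblock_ne_bot act t hocc)
  set ρ := eigenfieldAction act t hocc with hρ
  let w : eigenblock act t := ⟨w₀, hw₀⟩
  have hw0 : w ≠ 0 := fun h ↦ hw₀0 (congrArg Subtype.val h)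
  -- the orbit map `j : E → V`, `e ↦ ρ e w₀`
  let j : eigenfield t →ₗ[ℚ] V := (eigenblock act t).subtype ∘ₗ (LinearMap.applyₗ w ∘ₗ ρ.toLinearMap)
  have hj : ∀ e, j e = (ρ e w : V) := fun e ↦ rfl
  have hj_inj : Function.Injective j := by
    rw [injective_iff_map_eq_zero]
    intro e he
    by_contra he0
    have h1 : ρ e w = 0 := Subtype.val_injective (by rw [← hj, he]; rfl)
    have h2 : ρ (e⁻¹ * e) w = w := by rw [inv_mul_cancel₀ he0, map_one, Module.End.one_apply]
    rw [map_mul, Module.End.mul_apply, h1, map_zero] at h2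
    exact hw0 h2.symm
  -- `j` intertwines left multiplication by `t a` with `act a`
  have hj_mul : ∀ a : R, j ∘ₗ LinearMap.mulLeft ℚ (⟨t a, apply_mem_eigenfield t a⟩ : eigenfield t) = act a ∘ₗ j := by
    intro a
    ext z
    simp only [LinearMap.comp_apply, LinearMap.mulLeft_apply, hj, map_mul, Module.End.mul_apply]
    rw [coe_eigenfieldAction_apply act t hocc (a := a) rfl]
  -- a line of `ℂ ⊗ E` on which `E` acts through `τ`
  have h1 := finrank_iInf_eigenspace_baseChange_mulLeft_eq_one (τ.toRatAlgHom : eigenfield t →ₐ[ℚ] ℂ)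
  obtain ⟨z, hz, hz0⟩ := Submodule.exists_mem_ne_zero_of_ne_bot (p := ⨅ e : eigenfield t,
      Module.End.eigenspace ((LinearMap.mulLeft ℚ e).baseChange ℂ) ((τ.toRatAlgHom : eigenfield t →ₐ[ℚ] ℂ) e))
    (fun h ↦ by rw [h, finrank_bot] at h1; exact zero_ne_one h1)
  simp only [Submodule.mem_iInf, Module.End.mem_eigenspace_iff, RingHom.toRatAlgHom_apply] at hz
  refine ⟨j.baseChange ℂ z, fun h ↦ hz0 ?_, fun a ↦ ?_⟩
  · have hinj : Function.Injective (j.baseChange ℂ) := by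
      rw [LinearMap.baseChange_eq_ltensor]
      exact Module.Flat.lTensor_preserves_injective_linearMap j hj_inj
    exact hinj (by rw [h, map_zero])
  · rw [← LinearMap.comp_apply, ← LinearMap.baseChange_comp, ← hj_mul a, LinearMap.baseChange_comp,
      LinearMap.comp_apply, hz, map_smul]

omit [FiniteDimensional ℚ V] in
/-- **Complex conjugation `conj ⊗ id` carries joint eigenvectors of `χ` to joint eigenvectors of `conj ∘ χ`**
(the endomorphisms are `ℚ`-rational: `conj_baseChange`). [cite: Deligne1982HodgeCycles, §4] -/
theorem conj_eigenvector {χ : R → ℂ} {x : ℂ ⊗[ℚ] V} (hx : ∀ a, (act a).baseChange ℂ x = χ a • x) (a : R) :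
    (act a).baseChange ℂ (Motives.HodgeStructure.conj x) =
      starRingEnd ℂ (χ a) • Motives.HodgeStructure.conj x := by
  rw [← Motives.HodgeStructure.conj_baseChange, hx, Motives.HodgeStructure.conj_smul]

end Action

end Literature.AlgebraicGeometry.ComplexMultiplication

end
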